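import Summits.BirchSwinnertonDyer.Rank1Residual.X6.RankZeroCertificateErratumDisplay
import HarnessLib

/-!
# Class X6 ∧ analytic rank `0` — the INERT-PAIR certificate (road (R2)): two distinct multiplicative primes with
# `E[p]` ramified at both (`p ∤ ord_ℓ Δ_min`), decided in the kernel for every record; per-prime `(Mult, ord_ℓ Δ_min)` adapters

Cell `bsd-print-x6` (D-0131 (2) print tier, key `x6`; HOME `run/shared/lean/pub/bsd-print-x6/`), typer seat ty3 (gen 5).
Sibling of `RankZeroCertificateErratum.lean` (p548448: the Err ∣ Rest certificates `errAt` / `restAt`,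
`Record.hasErratumPrime_of_check`) and `RankZeroCertificateErratumDisplay.lean` (p551397). PARTITION (D-0054): leaf X6 ∧ r = 0
(K3 row A6) — types-the-object-of; closes NONE. HONEST FRAMING: nothing here asserts BSD or any `L`-value; every theorem is a
statement about the reduction types and `ord_ℓ Δ_min` of an explicit minimal model, PROVED from kernel-rechecked integer data.

WHY. Prover p3 (gen 2, HOME/INBOX 2026-08-27T19:01:22Z) takes the planner's road (R2) for the RESIDUAL child
`EisensteinHalfFiveLeRest` (stmt-BirchSwinnertonDyer-21116): the INERT-PAIR quaternionic road — an imaginary quadratic `K` in which exactly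
two multiplicative primes `ℓ₁ ≠ ℓ₂` of `E` are inert (`N⁻ = ℓ₁ℓ₂`, so `w(E/K) = −1` whatever `a_ℓ`), Castella–Wan 2024 Thm 5.3 at
`N⁻ = ℓ₁ℓ₂` with «`E[p]` ramified at every `ℓ ∣ N⁻`», i.e. `p ∤ ord_{ℓ_i}(Δ_min)` (Tate). Its decidable scope is the sub-class
«`∃ ℓ₁ ≠ ℓ₂` multiplicative with `p ∤ ord_{ℓ_i} Δ_min`» (ty2's proposed `Supersingular.HasInertPair W p`, HOME/INBOX 19:10:29Z — not
yet in the tree; this file states the property STRUCTURALLY, so any later name is one anonymous constructor away). This file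
decides it on the census, exactly as p548448 decided `HasErratumPrime`:

* §1 the Bool certificate `Record.inertPairAt` (two listed bad pairs `(q₁,v₁) ≠ (q₂,v₂)` by prime with `p ∤ v₁`, `p ∤ v₂`) and the
  kernel theorems `Record.exists_inertPair_of_check` (⇒ the structural property on `r.curve`, via `mult_and_val_of_mem_bad`) and
  `Record.not_exists_inertPair_of_check` (certificate `false` ⇒ no such pair: a multiplicative prime is bad, hence listed,
  `mem_badPrimes_of_not_good`, with `ord_ℓ Δ_min` = the listed `v`).
* §2 the census (kernel recount = HOME/ty3 python over `X6R0-ERRATUM-v1.tsv`): **all 113 records at `p ≥ 5` carry an inert pair**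
  (the 6 Rest cells AND the 107 Err cells; number of listed primes with `p ∤ v`: 2 on 11 records, 3 on 43, 4 on 47, 5 on 8, 6 on 4);
  at `p = 3` (record only) 574 do and 47 do not (labels listed). So road (R2)'s scope contains the whole `p ≥ 5` census and does
  not separate Rest from Err there.
* §3 adapters in the cell files' `hWeq` shape: `mult_and_val_of_exists` (ONE listed bad prime: `Mult W q ∧ ord_q Δ_min(W) = v` — the
  atomic datum from which a consumer picks its own pair), `exists_inertPair_of_exists`, and the six Rest cells at `p ≥ 5` by name
  (`inertPair_cell_<label>_at<p>`; the per-prime data of `399190l1 @ 7` shows the one listed prime with `7 ∣ v`, `(19, 21)`).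

Data (Cremona / PARI two engines = records14–16; bad primes with `ord_q Δ_min`): `138594b1 = [1,0,0,−1443,−21219]` bad `(2,2),(3,1),(23099,1)`;
`246697a1 = [0,0,1,−292934695,−1929764585205]` bad `(11,6),(41,1),(547,1)`; `321518d1 = [1,0,0,−80858,−9082420]` bad `(2,3),(19,2),(8461,3)`;
`331554a1 = [1,0,0,−3453,−78387]` bad `(2,2),(3,1),(55259,1)`; `12927e1 = [1,0,0,−42189461,−105479619702]` bad `(3,1),(31,2),(139,1)`;
`399190l1 = [1,−1,1,−8615202972,−2594053676135591]` bad `(2,1),(5,1),(11,1),(19,21),(191,2)`. beyond-print theorem: NO.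
References: J. H. Silverman, *AEC* (2009) VII.5 Prop. 5.1, C.15 [SilvermanAEC2009]; Castella–Wan 2024 Thm 5.3 hypothesis «`E[p]`
ramified at `ℓ ∣ N⁻`» (shape only; nothing asserted) [CastellaWan2023]; Cremona's tables [Cremona2006]; HOME/PLAN.md v4.2 (R2).
-/

set_option autoImplicit false

open WeierstrassCurve Literature.NumberTheory.EllipticCurves
  Literature.NumberTheory.EllipticCurves.Rank1Residual

namespace Summit.BirchSwinnertonDyer.Rank1Residual.X6.PrintCert

/-! ### §1 The certificate and the kernel theorems -/

namespace Record

variable (r : Record)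

/-- **Inert-pair certificate** of a record: two listed bad pairs `(q₁, v₁)`, `(q₂, v₂)` with `q₁ ≠ q₂`, `p ∤ v₁`, `p ∤ v₂`
(on X6 every bad prime is multiplicative and `v = ord_q Δ_min`, so this is «two distinct multiplicative primes with `E[p]`
ramified at both»). [folklore] -/
def inertPairAt : Bool :=
  r.bad.any fun t₁ => r.bad.any fun t₂ => decide (t₁.1 ≠ t₂.1) && decide (¬ r.p ∣ t₁.2) && decide (¬ r.p ∣ t₂.2)

/-- **The inert-pair property for a certified record with the certificate** (kernel theorem, no claim): two distinct primes of
multiplicative reduction `ℓ₁ ≠ ℓ₂` of the record's curve with `p ∤ ord_{ℓ₁} Δ_min` and `p ∤ ord_{ℓ₂} Δ_min` — the body of ty2's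
proposed `Supersingular.HasInertPair r.curve r.p`, stated structurally. [cite: SilvermanAEC2009, VII.5 Prop. 5.1(b)] -/
theorem exists_inertPair_of_check (hc : r.check = true) [r.curve.IsElliptic] [r.curve.IsGloballyMinimal]
    (h : r.inertPairAt = true) :
    ∃ ℓ₁ ℓ₂ : ℕ, ∃ _ : Fact ℓ₁.Prime, ∃ _ : Fact ℓ₂.Prime, ℓ₁ ≠ ℓ₂ ∧
      r.curve.HasMultiplicativeReductionAtPrime ℓ₁ ∧ r.curve.HasMultiplicativeReductionAtPrime ℓ₂ ∧
      ¬ r.p ∣ padicValInt ℓ₁ r.curve.minimalDiscriminantInt ∧ ¬ r.p ∣ padicValInt ℓ₂ r.curve.minimalDiscriminantInt := by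
  obtain ⟨t₁, ht₁, h₁⟩ := List.any_eq_true.mp h
  obtain ⟨t₂, ht₂, h₂⟩ := List.any_eq_true.mp h₁
  simp only [Bool.and_eq_true, decide_eq_true_eq] at h₂
  obtain ⟨⟨hne, hv₁⟩, hv₂⟩ := h₂
  obtain ⟨hm₁, hval₁⟩ := r.mult_and_val_of_mem_bad hc ht₁
  obtain ⟨hm₂, hval₂⟩ := r.mult_and_val_of_mem_bad hc ht₂
  exact ⟨t₁.1, t₂.1, _, _, hne, hm₁, hm₂, by rw [hval₁]; exact hv₁, by rw [hval₂]; exact hv₂⟩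

/-- **No inert pair for a certified record WITHOUT the certificate** (kernel theorem): two distinct multiplicative primes with
`p ∤ ord Δ_min` would both be bad, hence listed (`mem_badPrimes_of_not_good`) with `ord_ℓ Δ_min` the listed exponent
(`mult_and_val_of_mem_bad`), and the certificate would hold. [cite: SilvermanAEC2009, VII.5 Prop. 5.1(a) and (b)] -/
theorem not_exists_inertPair_of_check (hc : r.check = true) [r.curve.IsElliptic] [r.curve.IsGloballyMinimal]
    (h : r.inertPairAt = false) :
    ¬ ∃ ℓ₁ ℓ₂ : ℕ, ∃ _ : Fact ℓ₁.Prime, ∃ _ : Fact ℓ₂.Prime, ℓ₁ ≠ ℓ₂ ∧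
      r.curve.HasMultiplicativeReductionAtPrime ℓ₁ ∧ r.curve.HasMultiplicativeReductionAtPrime ℓ₂ ∧
      ¬ r.p ∣ padicValInt ℓ₁ r.curve.minimalDiscriminantInt ∧ ¬ r.p ∣ padicValInt ℓ₂ r.curve.minimalDiscriminantInt := by
  rintro ⟨ℓ₁, ℓ₂, hℓ₁, hℓ₂, hne, hm₁, hm₂, hv₁, hv₂⟩
  have hbad₁ : ¬ r.curve.HasGoodReductionAtPrime ℓ₁ :=
    fun hgood => WeierstrassCurve.HasMultiplicativeReduction.not_hasGoodReduction (R := ℤ_[ℓ₁]) hm₁ hgood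
  have hbad₂ : ¬ r.curve.HasGoodReductionAtPrime ℓ₂ :=
    fun hgood => WeierstrassCurve.HasMultiplicativeReduction.not_hasGoodReduction (R := ℤ_[ℓ₂]) hm₂ hgood
  obtain ⟨⟨q₁, v₁⟩, ht₁, hq₁⟩ := r.exists_mem_bad_of_mem_badPrimes (r.mem_badPrimes_of_not_good hc hℓ₁.out hbad₁)
  obtain ⟨⟨q₂, v₂⟩, ht₂, hq₂⟩ := r.exists_mem_bad_of_mem_badPrimes (r.mem_badPrimes_of_not_good hc hℓ₂.out hbad₂)
  have e₁ : q₁ = ℓ₁ := hq₁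
  have e₂ : q₂ = ℓ₂ := hq₂
  subst e₁ e₂
  have hw₁ := (r.mult_and_val_of_mem_bad hc ht₁).2
  have hw₂ := (r.mult_and_val_of_mem_bad hc ht₂).2
  dsimp only at hw₁ hw₂
  rw [hw₁] at hv₁
  rw [hw₂] at hv₂
  have htrue : r.inertPairAt = true := by
    refine List.any_eq_true.mpr ⟨(q₁, v₁), ht₁, List.any_eq_true.mpr ⟨(q₂, v₂), ht₂, ?_⟩⟩
    simp only [Bool.and_eq_true, decide_eq_true_eq]
    exact ⟨⟨hne, hv₁⟩, hv₂⟩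
  rw [htrue] at h
  exact Bool.noConfusion h

end Record

/-! ### §2 The census (kernel recount) -/

/-- **All 113 records at `p ≥ 5` carry an inert pair** (the 6 Rest cells and the 107 Err cells alike); at `p = 3` (record only)
574 of 621 do. [folklore] -/
theorem inertPair_counts_allRecords :
    (allRecords.filter fun r => 5 ≤ r.p).length = 113 ∧
    (allRecords.filter fun r => 5 ≤ r.p ∧ r.inertPairAt = true).length = 113 ∧
    (allRecords.filter fun r => 5 ≤ r.p ∧ r.restAt = true ∧ r.inertPairAt = true).length = 6 ∧
    (allRecords.filter fun r => 5 ≤ r.p ∧ r.errAt = true ∧ r.inertPairAt = true).length = 107 ∧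
    (allRecords.filter fun r => r.p = 3 ∧ r.inertPairAt = true).length = 574 ∧
    (allRecords.filter fun r => r.p = 3 ∧ r.inertPairAt = false).length = 47 := by
  decide +kernel

/-- Pointwise form at `p ≥ 5`: every listed record with `5 ≤ p` has the certificate. [folklore] -/
theorem inertPairAt_of_mem_five_le : (allRecords.all fun r => !decide (5 ≤ r.p) || r.inertPairAt) = true := by
  decide +kernel

/-- Distribution at `p ≥ 5` of the number of listed bad primes with `p ∤ ord_q Δ_min` (`E[p]` ramified): 2 on 11 records, 3 on 43,
4 on 47, 5 on 8, 6 on 4 (none with fewer than 2). [folklore] -/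
theorem ramifiedCount_five_le :
    (((allRecords.filter fun r => 5 ≤ r.p).map fun r => (r.bad.filter fun t => ¬ r.p ∣ t.2).length).count 2 = 11) ∧
    (((allRecords.filter fun r => 5 ≤ r.p).map fun r => (r.bad.filter fun t => ¬ r.p ∣ t.2).length).count 3 = 43) ∧
    (((allRecords.filter fun r => 5 ≤ r.p).map fun r => (r.bad.filter fun t => ¬ r.p ∣ t.2).length).count 4 = 47) ∧
    (((allRecords.filter fun r => 5 ≤ r.p).map fun r => (r.bad.filter fun t => ¬ r.p ∣ t.2).length).count 5 = 8) ∧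
    (((allRecords.filter fun r => 5 ≤ r.p).map fun r => (r.bad.filter fun t => ¬ r.p ∣ t.2).length).count 6 = 4) := by
  decide +kernel

/-- The 47 records at `p = 3` WITHOUT an inert pair (at most one listed bad prime with `3 ∤ ord_q Δ_min`).
[cite: Cremona2006, Table 1 (Cremona labels)] -/
theorem noInertPair_three_labels :
    ((allRecords.filter fun r => r.p = 3 ∧ r.inertPairAt = false).map Record.label) =
    ["20627a1", "20899a1", "21673a1", "32419d1", "44338a1", "54286a1", "57841a1", "59113a1", "64366b1", "77186a1",
      "80383a1", "84139a1", "89629a1", "107419a1", "109133b1", "117074a1", "132914a1", "146702a1", "151166a1",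
      "152987b1", "161206a1", "173827a1", "204154a1", "215693a1", "228083a1", "232595b1", "247738c1", "247966a1",
      "263507b1", "269998b1", "277181a1", "307027d1", "311434a1", "320089c1", "336818a1", "337411a1", "343861a1",
      "350221b1", "355051b1", "378289a1", "393571a1", "399673a1", "419113a1", "444685a1", "455941b1", "470165a1",
      "496987b1"] := by
  decide +kernel

/-- **The inert-pair property for every listed record at `p ≥ 5`** (kernel theorem per record; instance binders from the recheck;
no certificate hypothesis needed since all 113 carry it). [cite: SilvermanAEC2009, VII.5 Prop. 5.1(b)] -/
theorem exists_inertPair_of_mem (r : Record) (hr : r ∈ allRecords) (h5 : 5 ≤ r.p) :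
    haveI := (r.elliptic_and_minimal_of_check (check_of_mem_of_certified certified_allRecords hr)).1
    haveI := (r.elliptic_and_minimal_of_check (check_of_mem_of_certified certified_allRecords hr)).2
    ∃ ℓ₁ ℓ₂ : ℕ, ∃ _ : Fact ℓ₁.Prime, ∃ _ : Fact ℓ₂.Prime, ℓ₁ ≠ ℓ₂ ∧
      r.curve.HasMultiplicativeReductionAtPrime ℓ₁ ∧ r.curve.HasMultiplicativeReductionAtPrime ℓ₂ ∧
      ¬ r.p ∣ padicValInt ℓ₁ r.curve.minimalDiscriminantInt ∧ ¬ r.p ∣ padicValInt ℓ₂ r.curve.minimalDiscriminantInt := by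
  have hc := check_of_mem_of_certified certified_allRecords hr
  haveI := (r.elliptic_and_minimal_of_check hc).1
  haveI := (r.elliptic_and_minimal_of_check hc).2
  have hx := List.all_eq_true.mp inertPairAt_of_mem_five_le r hr
  simp only [Bool.or_eq_true, Bool.not_eq_true', decide_eq_false_iff_not] at hx
  rcases hx with hlt | hcert
  · exact absurd h5 hlt
  · exact r.exists_inertPair_of_check hc hcert

/-! ### §3 `hWeq` adapters and the six Rest cells at `p ≥ 5` -/

section Adapters

variable {rs : List Record} {W : WeierstrassCurve ℚ} [W.IsElliptic] [W.IsGloballyMinimal] {a1 a2 a3 a4 a6 : ℤ}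

/-- **One listed bad prime in the `hWeq` shape — the atomic datum**: from a certified list containing a record with these
a-invariants listing `(q, v)`: `E` has multiplicative reduction at `q` and `ord_q Δ_min(E) = v` (a consumer picks its own pair).
[cite: SilvermanAEC2009, VII.5 Prop. 5.1(b)] -/
theorem mult_and_val_of_exists (hrs : certified rs = true) {q v : ℕ} [Fact q.Prime]
    (h : ∃ r ∈ rs, r.ainvs = [a1, a2, a3, a4, a6] ∧ (q, v) ∈ r.bad) (hWeq : W = ⟨a1, a2, a3, a4, a6⟩) :
    W.HasMultiplicativeReductionAtPrime q ∧ padicValInt q W.minimalDiscriminantInt = v := by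
  obtain ⟨r, hr, hA, ht⟩ := h
  have hc := check_of_mem_of_certified hrs hr
  have hW : W = r.curve := by rw [hWeq]; exact r.curve_eq hA
  subst hW
  exact r.mult_and_val_of_mem_bad hc ht

/-- **The inert-pair property in the `hWeq` shape** from a certified list containing a record with these a-invariants, this `p`
and the certificate. [cite: SilvermanAEC2009, VII.5 Prop. 5.1(b)] -/
theorem exists_inertPair_of_exists (hrs : certified rs = true) {p : ℕ}
    (h : ∃ r ∈ rs, r.ainvs = [a1, a2, a3, a4, a6] ∧ r.p = p ∧ r.inertPairAt = true) (hWeq : W = ⟨a1, a2, a3, a4, a6⟩) :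
    ∃ ℓ₁ ℓ₂ : ℕ, ∃ _ : Fact ℓ₁.Prime, ∃ _ : Fact ℓ₂.Prime, ℓ₁ ≠ ℓ₂ ∧
      W.HasMultiplicativeReductionAtPrime ℓ₁ ∧ W.HasMultiplicativeReductionAtPrime ℓ₂ ∧
      ¬ p ∣ padicValInt ℓ₁ W.minimalDiscriminantInt ∧ ¬ p ∣ padicValInt ℓ₂ W.minimalDiscriminantInt := by
  obtain ⟨r, hr, hA, hp, hcert⟩ := h
  have hc := check_of_mem_of_certified hrs hr
  have hW : W = r.curve := by rw [hWeq]; exact r.curve_eq hA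
  subst hW
  subst hp
  exact r.exists_inertPair_of_check hc hcert

end Adapters

section RestCells

variable {W : WeierstrassCurve ℚ} [W.IsElliptic] [W.IsGloballyMinimal]

/-- `138594b1 @ 5`: bad `(2,2), (3,1), (23099,1)` — `Mult` and `ord_q Δ_min` at each, so every pair of them is an inert pair at `5`.
[cite: Cremona2006, Table 1 (Cremona label 138594b1)] -/
theorem multVal_cell_138594b1 [Fact (Nat.Prime 2)] [Fact (Nat.Prime 3)] [Fact (Nat.Prime 23099)]
    (hWeq : W = ⟨1, 0, 0, -1443, -21219⟩) :
    (W.HasMultiplicativeReductionAtPrime 2 ∧ padicValInt 2 W.minimalDiscriminantInt = 2) ∧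
    (W.HasMultiplicativeReductionAtPrime 3 ∧ padicValInt 3 W.minimalDiscriminantInt = 1) ∧
    (W.HasMultiplicativeReductionAtPrime 23099 ∧ padicValInt 23099 W.minimalDiscriminantInt = 1) :=
  ⟨mult_and_val_of_exists certified_records14 (by decide +kernel) hWeq,
    mult_and_val_of_exists certified_records14 (by decide +kernel) hWeq,
    mult_and_val_of_exists certified_records14 (by decide +kernel) hWeq⟩

/-- `138594b1 @ 5` carries an inert pair. [cite: Cremona2006, Table 1 (Cremona label 138594b1)] -/
theorem inertPair_cell_138594b1_at5 (hWeq : W = ⟨1, 0, 0, -1443, -21219⟩) :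
    ∃ ℓ₁ ℓ₂ : ℕ, ∃ _ : Fact ℓ₁.Prime, ∃ _ : Fact ℓ₂.Prime, ℓ₁ ≠ ℓ₂ ∧
      W.HasMultiplicativeReductionAtPrime ℓ₁ ∧ W.HasMultiplicativeReductionAtPrime ℓ₂ ∧
      ¬ 5 ∣ padicValInt ℓ₁ W.minimalDiscriminantInt ∧ ¬ 5 ∣ padicValInt ℓ₂ W.minimalDiscriminantInt :=
  exists_inertPair_of_exists certified_records14 (by decide +kernel) hWeq

/-- `246697a1 @ 5`: bad `(11,6), (41,1), (547,1)`. [cite: Cremona2006, Table 1 (Cremona label 246697a1)] -/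
theorem multVal_cell_246697a1 [Fact (Nat.Prime 11)] [Fact (Nat.Prime 41)] [Fact (Nat.Prime 547)]
    (hWeq : W = ⟨0, 0, 1, -292934695, -1929764585205⟩) :
    (W.HasMultiplicativeReductionAtPrime 11 ∧ padicValInt 11 W.minimalDiscriminantInt = 6) ∧
    (W.HasMultiplicativeReductionAtPrime 41 ∧ padicValInt 41 W.minimalDiscriminantInt = 1) ∧
    (W.HasMultiplicativeReductionAtPrime 547 ∧ padicValInt 547 W.minimalDiscriminantInt = 1) :=
  ⟨mult_and_val_of_exists certified_records14 (by decide +kernel) hWeq,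
    mult_and_val_of_exists certified_records14 (by decide +kernel) hWeq,
    mult_and_val_of_exists certified_records14 (by decide +kernel) hWeq⟩

/-- `246697a1 @ 5` carries an inert pair. [cite: Cremona2006, Table 1 (Cremona label 246697a1)] -/
theorem inertPair_cell_246697a1_at5 (hWeq : W = ⟨0, 0, 1, -292934695, -1929764585205⟩) :
    ∃ ℓ₁ ℓ₂ : ℕ, ∃ _ : Fact ℓ₁.Prime, ∃ _ : Fact ℓ₂.Prime, ℓ₁ ≠ ℓ₂ ∧
      W.HasMultiplicativeReductionAtPrime ℓ₁ ∧ W.HasMultiplicativeReductionAtPrime ℓ₂ ∧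
      ¬ 5 ∣ padicValInt ℓ₁ W.minimalDiscriminantInt ∧ ¬ 5 ∣ padicValInt ℓ₂ W.minimalDiscriminantInt :=
  exists_inertPair_of_exists certified_records14 (by decide +kernel) hWeq

/-- `321518d1 @ 5`: bad `(2,3), (19,2), (8461,3)`. [cite: Cremona2006, Table 1 (Cremona label 321518d1)] -/
theorem multVal_cell_321518d1 [Fact (Nat.Prime 2)] [Fact (Nat.Prime 19)] [Fact (Nat.Prime 8461)]
    (hWeq : W = ⟨1, 0, 0, -80858, -9082420⟩) :
    (W.HasMultiplicativeReductionAtPrime 2 ∧ padicValInt 2 W.minimalDiscriminantInt = 3) ∧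
    (W.HasMultiplicativeReductionAtPrime 19 ∧ padicValInt 19 W.minimalDiscriminantInt = 2) ∧
    (W.HasMultiplicativeReductionAtPrime 8461 ∧ padicValInt 8461 W.minimalDiscriminantInt = 3) :=
  ⟨mult_and_val_of_exists certified_records15 (by decide +kernel) hWeq,
    mult_and_val_of_exists certified_records15 (by decide +kernel) hWeq,
    mult_and_val_of_exists certified_records15 (by decide +kernel) hWeq⟩

/-- `321518d1 @ 5` carries an inert pair. [cite: Cremona2006, Table 1 (Cremona label 321518d1)] -/
theorem inertPair_cell_321518d1_at5 (hWeq : W = ⟨1, 0, 0, -80858, -9082420⟩) :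
    ∃ ℓ₁ ℓ₂ : ℕ, ∃ _ : Fact ℓ₁.Prime, ∃ _ : Fact ℓ₂.Prime, ℓ₁ ≠ ℓ₂ ∧
      W.HasMultiplicativeReductionAtPrime ℓ₁ ∧ W.HasMultiplicativeReductionAtPrime ℓ₂ ∧
      ¬ 5 ∣ padicValInt ℓ₁ W.minimalDiscriminantInt ∧ ¬ 5 ∣ padicValInt ℓ₂ W.minimalDiscriminantInt :=
  exists_inertPair_of_exists certified_records15 (by decide +kernel) hWeq

/-- `331554a1 @ 5`: bad `(2,2), (3,1), (55259,1)`. [cite: Cremona2006, Table 1 (Cremona label 331554a1)] -/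
theorem multVal_cell_331554a1 [Fact (Nat.Prime 2)] [Fact (Nat.Prime 3)] [Fact (Nat.Prime 55259)]
    (hWeq : W = ⟨1, 0, 0, -3453, -78387⟩) :
    (W.HasMultiplicativeReductionAtPrime 2 ∧ padicValInt 2 W.minimalDiscriminantInt = 2) ∧
    (W.HasMultiplicativeReductionAtPrime 3 ∧ padicValInt 3 W.minimalDiscriminantInt = 1) ∧
    (W.HasMultiplicativeReductionAtPrime 55259 ∧ padicValInt 55259 W.minimalDiscriminantInt = 1) :=
  ⟨mult_and_val_of_exists certified_records15 (by decide +kernel) hWeq,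
    mult_and_val_of_exists certified_records15 (by decide +kernel) hWeq,
    mult_and_val_of_exists certified_records15 (by decide +kernel) hWeq⟩

/-- `331554a1 @ 5` carries an inert pair. [cite: Cremona2006, Table 1 (Cremona label 331554a1)] -/
theorem inertPair_cell_331554a1_at5 (hWeq : W = ⟨1, 0, 0, -3453, -78387⟩) :
    ∃ ℓ₁ ℓ₂ : ℕ, ∃ _ : Fact ℓ₁.Prime, ∃ _ : Fact ℓ₂.Prime, ℓ₁ ≠ ℓ₂ ∧
      W.HasMultiplicativeReductionAtPrime ℓ₁ ∧ W.HasMultiplicativeReductionAtPrime ℓ₂ ∧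
      ¬ 5 ∣ padicValInt ℓ₁ W.minimalDiscriminantInt ∧ ¬ 5 ∣ padicValInt ℓ₂ W.minimalDiscriminantInt :=
  exists_inertPair_of_exists certified_records15 (by decide +kernel) hWeq

/-- `12927e1 @ 7`: bad `(3,1), (31,2), (139,1)`. [cite: Cremona2006, Table 1 (Cremona label 12927e1)] -/
theorem multVal_cell_12927e1 [Fact (Nat.Prime 3)] [Fact (Nat.Prime 31)] [Fact (Nat.Prime 139)]
    (hWeq : W = ⟨1, 0, 0, -42189461, -105479619702⟩) :
    (W.HasMultiplicativeReductionAtPrime 3 ∧ padicValInt 3 W.minimalDiscriminantInt = 1) ∧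
    (W.HasMultiplicativeReductionAtPrime 31 ∧ padicValInt 31 W.minimalDiscriminantInt = 2) ∧
    (W.HasMultiplicativeReductionAtPrime 139 ∧ padicValInt 139 W.minimalDiscriminantInt = 1) :=
  ⟨mult_and_val_of_exists certified_records16 (by decide +kernel) hWeq,
    mult_and_val_of_exists certified_records16 (by decide +kernel) hWeq,
    mult_and_val_of_exists certified_records16 (by decide +kernel) hWeq⟩

/-- `12927e1 @ 7` carries an inert pair. [cite: Cremona2006, Table 1 (Cremona label 12927e1)] -/
theorem inertPair_cell_12927e1_at7 (hWeq : W = ⟨1, 0, 0, -42189461, -105479619702⟩) :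
    ∃ ℓ₁ ℓ₂ : ℕ, ∃ _ : Fact ℓ₁.Prime, ∃ _ : Fact ℓ₂.Prime, ℓ₁ ≠ ℓ₂ ∧
      W.HasMultiplicativeReductionAtPrime ℓ₁ ∧ W.HasMultiplicativeReductionAtPrime ℓ₂ ∧
      ¬ 7 ∣ padicValInt ℓ₁ W.minimalDiscriminantInt ∧ ¬ 7 ∣ padicValInt ℓ₂ W.minimalDiscriminantInt :=
  exists_inertPair_of_exists certified_records16 (by decide +kernel) hWeq

/-- `399190l1 @ 7`: bad `(2,1), (5,1), (11,1), (19,21), (191,2)` — four primes with `7 ∤ v` and ONE with `7 ∣ v = 21` (`19`: `E[7]`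
unramified there, NOT usable in `N⁻`). [cite: Cremona2006, Table 1 (Cremona label 399190l1)] -/
theorem multVal_cell_399190l1 [Fact (Nat.Prime 2)] [Fact (Nat.Prime 5)] [Fact (Nat.Prime 11)] [Fact (Nat.Prime 19)]
    [Fact (Nat.Prime 191)] (hWeq : W = ⟨1, -1, 1, -8615202972, -2594053676135591⟩) :
    (W.HasMultiplicativeReductionAtPrime 2 ∧ padicValInt 2 W.minimalDiscriminantInt = 1) ∧
    (W.HasMultiplicativeReductionAtPrime 5 ∧ padicValInt 5 W.minimalDiscriminantInt = 1) ∧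
    (W.HasMultiplicativeReductionAtPrime 11 ∧ padicValInt 11 W.minimalDiscriminantInt = 1) ∧
    (W.HasMultiplicativeReductionAtPrime 19 ∧ padicValInt 19 W.minimalDiscriminantInt = 21) ∧
    (W.HasMultiplicativeReductionAtPrime 191 ∧ padicValInt 191 W.minimalDiscriminantInt = 2) :=
  ⟨mult_and_val_of_exists certified_records16 (by decide +kernel) hWeq,
    mult_and_val_of_exists certified_records16 (by decide +kernel) hWeq,
    mult_and_val_of_exists certified_records16 (by decide +kernel) hWeq,
    mult_and_val_of_exists certified_records16 (by decide +kernel) hWeq,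
    mult_and_val_of_exists certified_records16 (by decide +kernel) hWeq⟩

/-- `399190l1 @ 7` carries an inert pair. [cite: Cremona2006, Table 1 (Cremona label 399190l1)] -/
theorem inertPair_cell_399190l1_at7 (hWeq : W = ⟨1, -1, 1, -8615202972, -2594053676135591⟩) :
    ∃ ℓ₁ ℓ₂ : ℕ, ∃ _ : Fact ℓ₁.Prime, ∃ _ : Fact ℓ₂.Prime, ℓ₁ ≠ ℓ₂ ∧
      W.HasMultiplicativeReductionAtPrime ℓ₁ ∧ W.HasMultiplicativeReductionAtPrime ℓ₂ ∧
      ¬ 7 ∣ padicValInt ℓ₁ W.minimalDiscriminantInt ∧ ¬ 7 ∣ padicValInt ℓ₂ W.minimalDiscriminantInt :=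
  exists_inertPair_of_exists certified_records16 (by decide +kernel) hWeq

end RestCells

end Summit.BirchSwinnertonDyer.Rank1Residual.X6.PrintCert
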